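/-
Copyright (c) 2026 the pub-hodgecm-mathlib formalisation cell (harness21).  Prover seat hodgecm-mathlib-K2E5-p16 (g5): Track B «K2-LIT»,
hLiu418 = stmt-HodgeConjecture-24832, ROAD Φ junction `K2LiuKFiniteSectionWhittakerHolomorphyGrowth`, file (E): ★ (7c)∕(7d) made ABSTRACT —
Cauchy bounds for the Taylor jets of a holomorphic function on a disc, and holomorphy IN A PARAMETER of those jets; 2026-09-04.
-/
import Mathlib.Analysis.Complex.Liouville
import Mathlib.Analysis.Complex.CauchyIntegral
import Mathlib.Analysis.Calculus.ParametricIntervalIntegral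
import Mathlib.MeasureTheory.Integral.CircleIntegral
import HarnessLib

/-!
# Crux `HLiu418`, ROAD Φ — file (E): Taylor jets at `0` of a holomorphic family `τ ↦ G s τ`: Cauchy bounds, and holomorphy in `s`

Cell `hodgecm-mathlib`, crux item hLiu418 = `stmt-HodgeConjecture-24832`, route of record `HCCMUnconditional`; squad K2, LEAD F0P6-plan (g13),
prover K2E5-p16 (g5).  THEOREMS ONLY, Mathlib-only imports; lane `--supports stmt-HodgeConjecture-24832 --as helper`.  This is the engine of
★ (7c) `norm_iteratedDeriv_xiShift_param_le` and ★ (7d) `differentiableOn_iteratedDeriv_xiShift_param` with the special function replaced by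
an arbitrary family, so that the junction can run it on the scalar jets `τ ↦ det(1 + τΞ)^{w(s)}` of K2Liu-p05 (g4)'s (V-4) letter as well.

* `norm_iteratedDeriv_le_of_forall_norm_le` — `Φ` holomorphic on `ball 0 r`, `‖Φ‖ ≤ B` on `‖t‖ ≤ r`, `0 < ρ < r` ⇒
  `‖iteratedDeriv n Φ 0‖ ≤ n!·B∕ρ^n` (Cauchy estimate, ★ Mathlib `Complex.norm_iteratedDeriv_le_of_forall_mem_sphere_norm_le`).
* `differentiableOn_iteratedDeriv_of_param` — `G : ℂ → ℂ → ℂ` with `τ ↦ G s τ` holomorphic on `ball 0 r` for every `s ∈ U` (open),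
  `s ↦ G s z` holomorphic on `U` for every `‖z‖ < r`, and `G` bounded on `K × ball 0 r` for every compact `K ⊆ U` ⇒ for every `n`,
  `s ↦ iteratedDeriv n (G s) 0` is holomorphic on `U` (Cauchy's formula on `C(0, r∕2)`, Lipschitz-in-`s` domination from the Cauchy estimate for
  the `s`-derivative, ★ `intervalIntegral.hasDerivAt_integral_of_dominated_loc_of_lip`).
HONEST LABEL.  Count-neutral helper of the K2_Liu road; it pays no socket by itself: `HC_CM` is proved only modulo the 7 printed citations
(2 remaining named inputs: hLiu418 = `stmt-HodgeConjecture-24832`, h413 = `stmt-HodgeConjecture-24833`) until rung 0 closes.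
-/

set_option autoImplicit false
-- the mandated namespace repeats the single-problem summit's segment (`HodgeConjecture.HodgeConjecture`)
set_option linter.dupNamespace false

noncomputable section

open Complex MeasureTheory Set Filter Topology
open scoped Real Interval

namespace Summit.HodgeConjecture.HodgeConjecture.Cruxes.HLiu418.K2LiuHolomorphicJetsOfParameter

/-- **CAUCHY BOUND FOR THE JETS AT `0`**: `Φ` holomorphic on `ball 0 r`, `‖Φ t‖ ≤ B` for `‖t‖ ≤ r`, `0 < ρ < r` ⇒
`‖iteratedDeriv n Φ 0‖ ≤ n! · B ∕ ρ^n`. [folklore] (Cauchy) -/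
theorem norm_iteratedDeriv_le_of_forall_norm_le {Φ : ℂ → ℂ} {r ρ B : ℝ} (hρ : 0 < ρ) (hρr : ρ < r)
    (hdiff : DifferentiableOn ℂ Φ (Metric.ball 0 r)) (hB : ∀ t : ℂ, ‖t‖ ≤ r → ‖Φ t‖ ≤ B) (n : ℕ) :
    ‖iteratedDeriv n Φ 0‖ ≤ n.factorial * B / ρ ^ n := by
  have hcl : Metric.closedBall (0 : ℂ) ρ ⊆ Metric.ball 0 r := Metric.closedBall_subset_ball hρr
  have hf : DiffContOnCl ℂ Φ (Metric.ball 0 ρ) := by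
    refine ⟨hdiff.mono (Metric.ball_subset_ball hρr.le), ?_⟩
    rw [closure_ball (0 : ℂ) hρ.ne']
    exact hdiff.continuousOn.mono hcl
  refine Complex.norm_iteratedDeriv_le_of_forall_mem_sphere_norm_le n hρ hf fun z hz => hB z ?_
  have : ‖z‖ = ρ := by simpa using hz
  linarith

/-- **HOLOMORPHY IN THE PARAMETER OF THE JETS AT `0`**: see the module docstring. [folklore] (Cauchy's formula + dominated differentiation) -/
theorem differentiableOn_iteratedDeriv_of_param {G : ℂ → ℂ → ℂ} {U : Set ℂ} (hU : IsOpen U) {r : ℝ} (hr : 0 < r)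
    (hτ : ∀ s ∈ U, DifferentiableOn ℂ (G s) (Metric.ball 0 r))
    (hs : ∀ z : ℂ, ‖z‖ < r → DifferentiableOn ℂ (fun s => G s z) U)
    (hbd : ∀ K ⊆ U, IsCompact K → ∃ B : ℝ, ∀ s ∈ K, ∀ z : ℂ, ‖z‖ < r → ‖G s z‖ ≤ B) (n : ℕ) :
    DifferentiableOn ℂ (fun s : ℂ => iteratedDeriv n (G s) 0) U := by
  set ρ : ℝ := r / 2 with hρ
  have hρ0 : 0 < ρ := by rw [hρ]; linarith
  have hρr : ρ < r := by rw [hρ]; linarith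
  -- the integrand of the Cauchy formula, as a function of `(s, θ)`
  set Φ : ℂ → ℝ → ℂ := fun s θ => deriv (circleMap 0 ρ) θ • ((1 / (circleMap 0 ρ θ - 0) ^ (n + 1)) • G s (circleMap 0 ρ θ)) with hΦ
  -- (1) Cauchy's formula on `U`
  have hCauchy : ∀ s ∈ U, iteratedDeriv n (G s) 0 = (2 * π * I / n.factorial)⁻¹ • ∫ θ in (0 : ℝ)..2 * π, Φ s θ := by
    intro s hsU
    have hdiff := hτ s hsU
    have hf : DiffContOnCl ℂ (G s) (Metric.ball 0 ρ) := by
      refine ⟨hdiff.mono (Metric.ball_subset_ball hρr.le), ?_⟩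
      rw [closure_ball (0 : ℂ) hρ0.ne']
      exact hdiff.continuousOn.mono (Metric.closedBall_subset_ball hρr)
    have hcf := hf.circleIntegral_one_div_sub_center_pow_smul hρ0 n
    have hc : (2 * π * I / n.factorial : ℂ) ≠ 0 := div_ne_zero two_pi_I_ne_zero (by exact_mod_cast n.factorial_ne_zero)
    have hI : ∫ θ in (0 : ℝ)..2 * π, Φ s θ = ∮ z in C(0, ρ), (1 / (z - 0) ^ (n + 1)) • G s z := rfl
    rw [hI, hcf, smul_smul, inv_mul_cancel₀ hc, one_smul]
  refine (DifferentiableOn.const_smul (c := (2 * π * I / n.factorial : ℂ)⁻¹) ?_).congr fun s hsU => hCauchy s hsU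
  -- (2) holomorphy in `s` of the circle integral, at a point `s₀ ∈ U`
  intro s₀ hs₀
  obtain ⟨ε₀, hε₀, hballU⟩ := Metric.isOpen_iff.mp hU s₀ hs₀
  set ε : ℝ := ε₀ / 3 with hε
  have hεpos : 0 < ε := by rw [hε]; positivity
  have hcbU : Metric.closedBall s₀ (2 * ε) ⊆ U := (Metric.closedBall_subset_ball (by rw [hε]; linarith)).trans hballU
  -- the uniform bound on `closedBall s₀ 2ε × ball 0 r`
  obtain ⟨B₀, hB₀⟩ := hbd _ hcbU (isCompact_closedBall _ _)
  set B : ℝ := max B₀ 0 with hBdef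
  have hB0 : 0 ≤ B := le_max_right _ _
  have hBound : ∀ t : ℂ, ‖t‖ < r → ∀ s ∈ Metric.closedBall s₀ (2 * ε), ‖G s t‖ ≤ B :=
    fun t ht s hsK => (hB₀ s hsK t ht).trans (le_max_left _ _)
  set M : ℝ := ρ * ((ρ ^ (n + 1))⁻¹ * B) with hMdef
  have hM0 : 0 ≤ M := by positivity
  -- the points of the circle lie in the open disc of radius `r`
  have hzr : ∀ θ : ℝ, ‖circleMap 0 ρ θ‖ < r := fun θ => by rw [norm_circleMap_zero, abs_of_pos hρ0]; exact hρr
  have hzball : ∀ θ : ℝ, circleMap 0 ρ θ ∈ Metric.ball (0 : ℂ) r := fun θ => by rw [mem_ball_zero_iff]; exact hzr θ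
  -- (a) `Φ · θ` is holomorphic on `U` for every `θ`
  have hΦdiff : ∀ θ : ℝ, DifferentiableOn ℂ (fun s => Φ s θ) U := by
    intro θ
    simp only [hΦ]
    exact ((hs (circleMap 0 ρ θ) (hzr θ)).const_smul (1 / (circleMap 0 ρ θ - 0) ^ (n + 1))).const_smul (deriv (circleMap 0 ρ) θ)
  -- (b) the bound `‖Φ s θ‖ ≤ M` on the closed ball
  have hΦle : ∀ θ : ℝ, ∀ s ∈ Metric.closedBall s₀ (2 * ε), ‖Φ s θ‖ ≤ M := by
    intro θ s hsK
    simp only [hΦ]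
    rw [norm_smul, norm_smul, deriv_circleMap, norm_mul, Complex.norm_I, mul_one, norm_circleMap_zero, abs_of_pos hρ0, sub_zero,
      norm_div, norm_one, norm_pow, norm_circleMap_zero, abs_of_pos hρ0, one_div]
    exact mul_le_mul_of_nonneg_left (mul_le_mul_of_nonneg_left (hBound _ (hzr θ) s hsK) (by positivity)) hρ0.le
  -- (c) `Φ · θ` is `M/ε`-Lipschitz on `ball s₀ ε`
  have hLip : ∀ θ : ℝ, LipschitzOnWith (Real.nnabs (M / ε)) (fun s => Φ s θ) (Metric.ball s₀ ε) := by
    intro θ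
    have hdU : ∀ s ∈ Metric.ball s₀ ε, DifferentiableAt ℂ (fun s => Φ s θ) s := fun s hsb =>
      (hΦdiff θ).differentiableAt (hU.mem_nhds (hcbU (Metric.ball_subset_closedBall
        (Metric.ball_subset_ball (by linarith) hsb))))
    refine Convex.lipschitzOnWith_of_nnnorm_deriv_le hdU (fun s hsb => ?_) (convex_ball s₀ ε)
    have hsub : Metric.closedBall s ε ⊆ Metric.closedBall s₀ (2 * ε) := by
      intro z hz
      rw [Metric.mem_closedBall] at hz ⊢
      have := Metric.mem_ball.mp hsb
      linarith [dist_triangle z s s₀]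
    have hf : DiffContOnCl ℂ (fun s => Φ s θ) (Metric.ball s ε) := by
      refine ⟨(hΦdiff θ).mono ((Metric.ball_subset_closedBall).trans (hsub.trans hcbU)), ?_⟩
      rw [closure_ball s hεpos.ne']
      exact (hΦdiff θ).continuousOn.mono (hsub.trans hcbU)
    have hder := Complex.norm_deriv_le_of_forall_mem_sphere_norm_le hεpos hf fun z hz => hΦle θ z (hsub (Metric.sphere_subset_closedBall hz))
    have hcoe : ((Real.nnabs (M / ε) : NNReal) : ℝ) = M / ε := by rw [Real.coe_nnabs, abs_of_nonneg (by positivity)]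
    rw [← NNReal.coe_le_coe, coe_nnnorm, hcoe]
    exact hder
  -- (d) measurability in `θ`: continuity
  have hΦcont : ∀ s ∈ U, Continuous (fun θ : ℝ => Φ s θ) := by
    intro s hsU
    simp only [hΦ, deriv_circleMap]
    have hF : Continuous (fun θ : ℝ => G s (circleMap 0 ρ θ)) := (hτ s hsU).continuousOn.comp_continuous (continuous_circleMap 0 ρ) hzball
    have ha : Continuous (fun θ : ℝ => circleMap 0 ρ θ * I) := (continuous_circleMap 0 ρ).mul continuous_const
    have hb : Continuous (fun θ : ℝ => (1 : ℂ) / (circleMap 0 ρ θ - 0) ^ (n + 1)) :=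
      continuous_const.div (((continuous_circleMap 0 ρ).sub continuous_const).pow _)
        fun θ => pow_ne_zero _ (sub_ne_zero.mpr (circleMap_ne_center hρ0.ne'))
    exact ha.smul (hb.smul hF)
  -- (e) the `s`-derivative at `s₀` is measurable in `θ` (limit of difference quotients along `s₀ + ε/(k+2)`)
  have hderiv : ∀ θ : ℝ, HasDerivAt (fun s => Φ s θ) (deriv (fun s => Φ s θ) s₀) s₀ := fun θ =>
    ((hΦdiff θ).differentiableAt (hU.mem_nhds hs₀)).hasDerivAt
  have hF'meas : AEStronglyMeasurable (fun θ : ℝ => deriv (fun s => Φ s θ) s₀) (volume.restrict (Ι (0 : ℝ) (2 * π))) := by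
    set τ : ℕ → ℂ := fun k => ((ε / ((k : ℝ) + 2) : ℝ) : ℂ) with hτdef
    have hτpos : ∀ k : ℕ, 0 < ε / ((k : ℝ) + 2) := fun k => by positivity
    have hτU : ∀ k : ℕ, s₀ + τ k ∈ U := by
      intro k
      refine hcbU ?_
      rw [Metric.mem_closedBall, dist_eq_norm, add_sub_cancel_left, hτdef, Complex.norm_real, Real.norm_of_nonneg (hτpos k).le]
      have hk : (0 : ℝ) ≤ k := Nat.cast_nonneg k
      have : ε / ((k : ℝ) + 2) ≤ ε := div_le_self hεpos.le (by linarith)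
      linarith
    have hτlim : Tendsto τ atTop (𝓝[≠] 0) := by
      refine tendsto_nhdsWithin_iff.mpr ⟨?_, Filter.Eventually.of_forall fun k => ?_⟩
      · have h1 : Tendsto (fun k : ℕ => ε / ((k : ℝ) + 2)) atTop (𝓝 0) := by
          have h0 := (tendsto_const_div_atTop_nhds_zero_nat ε).comp (tendsto_add_atTop_nat 2)
          refine h0.congr fun k => ?_
          simp only [Function.comp_apply, Nat.cast_add, Nat.cast_ofNat]
        have h2 := (continuous_ofReal.tendsto 0).comp h1
        rwa [ofReal_zero] at h2
      · exact ofReal_ne_zero.mpr (hτpos k).ne'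
    have hlim : ∀ θ : ℝ, Tendsto (fun k : ℕ => (τ k)⁻¹ • (Φ (s₀ + τ k) θ - Φ s₀ θ)) atTop (𝓝 (deriv (fun s => Φ s θ) s₀)) :=
      fun θ => (hasDerivAt_iff_tendsto_slope_zero.mp (hderiv θ)).comp hτlim
    refine aestronglyMeasurable_of_tendsto_ae atTop (fun k => ?_) (Filter.Eventually.of_forall hlim)
    exact (((hΦcont _ (hτU k)).sub (hΦcont s₀ hs₀)).const_smul ((τ k)⁻¹)).aestronglyMeasurable
  -- (f) differentiate under the integral sign
  have hmain := intervalIntegral.hasDerivAt_integral_of_dominated_loc_of_lip (μ := volume) (a := 0) (b := 2 * π)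
    (F := Φ) (F' := fun θ => deriv (fun s => Φ s θ) s₀) (x₀ := s₀) (s := Metric.ball s₀ ε) (bound := fun _ => M / ε)
    (Metric.ball_mem_nhds s₀ hεpos) ?_ ((hΦcont s₀ hs₀).intervalIntegrable _ _) hF'meas
    (ae_of_all _ fun θ _ => hLip θ) intervalIntegrable_const (ae_of_all _ fun θ _ => hderiv θ)
  · exact hmain.2.differentiableAt.differentiableWithinAt
  · exact Filter.eventually_of_mem (hU.mem_nhds hs₀) fun s hsU => (hΦcont s hsU).aestronglyMeasurable

end Summit.HodgeConjecture.HodgeConjecture.Cruxes.HLiu418.K2LiuHolomorphicJetsOfParameter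

end
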